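import Mathlib
import HarnessLib
import Summits.Ventures.LatticeQCDFlow.Scaling.AutoregressiveProposalAcceptance

/-!
# LatticeQCDFlow / Scaling — the acceptance form, THE OTHER SIDE: along a generation order the
# per-coordinate conditional errors ADD UP AT MOST LINEARLY, so an exact sampler whose every conditional
# is accurate accepts at rate `≥ (1 − Σ_k δ_k/2)²`

HONEST FRAMING: exact (Metropolis-corrected) sampling algorithms for lattice gauge theory;
figures of merit are autocorrelation/cost numbers at stated couplings and volumes; no
continuum-physics claim.

Venture `LatticeQCDFlow` (cell pub-lqcd), topic `Scaling`, FANOUT row 30 (lean-1, GEN-19) — OUR WORK,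
companion of `Scaling/AutoregressiveProposalAcceptance` (NECESSITY: `ā ≤ 1 − δ_a/4` for the conditional
error `δ_a = Z⁻¹∫|A_s F − q_a·A_{insert a s} F| dπ` at any ONE coordinate).  Here SUFFICIENCY.

## Setting

`π = ⊗_ι μ` on `ι → X` (`μ` a probability measure), bounded measurable target weight `F ≥ 0`,
`Z = ∫ F dπ > 0`.  A BLOCK `l = [a₁, …, a_m]` of coordinates in generation order with conditionals
`q_{a_k} ≥ 0` (bounded measurable, normalised in `a_k`, and AUTOREGRESSIVE along `l`: `q_{a_k}` does not
read the later coordinates `a_{k+1}, …, a_m` — `l.Pairwise`), `s_k = {a_{k+1}, …, a_m}`.  The HYBRID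
proposal `H_l = (∏_k q_{a_k})·A_{s_0} F / Z` draws the context (coordinates off `l`) exactly and the block
from the model; for `l` = all coordinates it is the autoregressive model itself (`A_univ F = Z`).

## What is proved (all [ours])

* §1 `arProd_props`, **`pi_integral_mul_arTail`** — an autoregressive tail integrates away:
  `∫ Ψ·∏_{b∈l} q_b dπ = ∫ Ψ dπ` for `Ψ` blind to the coordinates of `l`.
* §2 **`integral_abs_sub_arHybrid_cons`** (one hybrid step) and
  **`integral_abs_sub_arHybrid_le_sum`** (THE CHAIN):
  `∫ |F − (∏_k q_{a_k})·A_{s_0}F| dπ ≤ Σ_k ∫ |A_{s_k}F − q_{a_k}·A_{s_{k−1}}F| dπ` — the joint `L¹` error of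
  the hybrid is at most the SUM of the per-coordinate conditional errors (each measured against the
  exact context law, exactly the quantities of the necessity theorem).
* §3 **`meanAccept_ge_of_arHybrid`** — with `Σ = Σ_k ∫|A_{s_k}F − q_{a_k}A_{s_{k−1}}F| dπ ≤ 2Z`, the
  equilibrium acceptance of the exact independence-Metropolis sampler with target `F/Z` and proposal
  `H_l` satisfies `ā ≥ (∫ min(F/Z, H_l))² ≥ (1 − Σ/(2Z))²` (tree `overlap_sq_le_meanAccept` + Scheffé).

READING (value-free): TWO-SIDED CONTROL of the venture's figure of merit by per-coordinate conditional
errors `δ_k` (in units of `Z`): `(1 − ½Σ_k δ_k)² ≤ ā ≤ 1 − ¼ max_k δ_k`.  An autoregressive sampler is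
exactly as good as its conditionals, coordinate by coordinate; the cell's context lower bounds say which
conditionals cannot be good.  NOT CLAIMED: sharp constants; dependence structure beyond the sum; anything
on autocorrelations beyond the acceptance.  No `def`, no `sorry`, nothing cited as a fact.
-/

noncomputable section

namespace Summit.Ventures.LatticeQCDFlow.Theory2.Autoregressive

open MeasureTheory Function Set
open Summit.Ventures.LatticeQCDFlow.Exactness

variable {ι : Type*} [Fintype ι] [DecidableEq ι] {X : Type*} [MeasurableSpace X]
variable (μ : Measure X) [IsProbabilityMeasure μ]

/-! ## §1 Autoregressive products and tails -/

omit [Fintype ι] [DecidableEq ι] [IsProbabilityMeasure μ] in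
/-- The product of the conditionals along a block is measurable, non-negative and bounded. [ours] -/
theorem arProd_props {q : ι → (ι → X) → ℝ} (hqm : ∀ a, Measurable (q a)) (hq0 : ∀ a ω, 0 ≤ q a ω)
    {Cq : ℝ} (hqb : ∀ a ω, q a ω ≤ Cq) (hCq : 0 ≤ Cq) (l : List ι) :
    (Measurable fun ω => (l.map fun b => q b ω).prod) ∧ (∀ ω, 0 ≤ (l.map fun b => q b ω).prod) ∧
      ∀ ω, (l.map fun b => q b ω).prod ≤ Cq ^ l.length := by
  induction l with
  | nil =>
    refine ⟨?_, fun ω => by simp, fun ω => by simp⟩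
    simp only [List.map_nil, List.prod_nil]
    exact measurable_const
  | cons b l' ih =>
    obtain ⟨ihm, ih0, ihb⟩ := ih
    refine ⟨?_, fun ω => ?_, fun ω => ?_⟩
    · simp only [List.map_cons, List.prod_cons]
      exact (hqm b).mul ihm
    · simpa only [List.map_cons, List.prod_cons] using mul_nonneg (hq0 b ω) (ih0 ω)
    · simp only [List.map_cons, List.prod_cons, List.length_cons, pow_succ']
      exact mul_le_mul (hqb b ω) (ihb ω) (ih0 ω) hCq

/-- **An autoregressive tail integrates away**: if the conditionals along `l` are normalised in their own
coordinate and do not read the later coordinates of `l`, then `∫ Ψ·∏_{b∈l} q_b dπ = ∫ Ψ dπ` for every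
bounded measurable `Ψ` blind to the coordinates of `l`. [ours] -/
theorem pi_integral_mul_arTail {q : ι → (ι → X) → ℝ} (hqm : ∀ a, Measurable (q a))
    (hq0 : ∀ a ω, 0 ≤ q a ω) {Cq : ℝ} (hqb : ∀ a ω, q a ω ≤ Cq)
    (hq1 : ∀ a ω, ∫ v, q a (update ω a v) ∂μ = 1) :
    ∀ (l : List ι), l.Pairwise (fun a b => ∀ ω v, q a (update ω b v) = q a ω) →
      ∀ {Ψ : (ι → X) → ℝ}, Measurable Ψ → ∀ {C : ℝ}, (∀ ω, |Ψ ω| ≤ C) →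
        (∀ b ∈ l, ∀ ω v, Ψ (update ω b v) = Ψ ω) →
          ∫ ω, Ψ ω * (l.map fun b => q b ω).prod ∂Measure.pi (fun _ : ι => μ) =
            ∫ ω, Ψ ω ∂Measure.pi (fun _ : ι => μ) := by
  intro l
  induction l with
  | nil => intro _ Ψ _ C _ _; simp
  | cons b l' ih =>
    intro hpw Ψ hΨm C hΨb hΨl
    rw [List.pairwise_cons] at hpw
    obtain ⟨hb, hpw'⟩ := hpw
    have hqabs : ∀ ω, |q b ω| ≤ Cq := fun ω => by rw [abs_of_nonneg (hq0 b ω)]; exact hqb b ω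
    -- `Ψ·q_b` is blind to the coordinates of `l'`
    have hΨ'm : Measurable fun ω => Ψ ω * q b ω := hΨm.mul (hqm b)
    have hΨ'b : ∀ ω, |Ψ ω * q b ω| ≤ C * Cq := fun ω => by
      rw [abs_mul]
      exact mul_le_mul (hΨb ω) (hqabs ω) (abs_nonneg _) ((abs_nonneg _).trans (hΨb ω))
    have hΨ'l : ∀ c ∈ l', ∀ ω v, Ψ (update ω c v) * q b (update ω c v) = Ψ ω * q b ω := by
      intro c hc ω v
      rw [hΨl c (List.mem_cons_of_mem b hc) ω v, hb c hc ω v]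
    have step : ∫ ω, Ψ ω * ((b :: l').map fun b => q b ω).prod ∂Measure.pi (fun _ : ι => μ) =
        ∫ ω, (Ψ ω * q b ω) * (l'.map fun b => q b ω).prod ∂Measure.pi (fun _ : ι => μ) := by
      refine integral_congr_ae (ae_of_all _ fun ω => ?_)
      simp only [List.map_cons, List.prod_cons, mul_assoc]
    rw [step, ih hpw' hΨ'm hΨ'b hΨ'l]
    exact pi_integral_mul_eq_of_normalised μ (hqm b) hqabs (hq1 b) hΨm hΨb
      (fun ω v => hΨl b (List.mem_cons_self) ω v)

/-! ## §2 The chain of hybrids -/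

/-- **One hybrid step.**  `∫ |F − (q_a·∏_{l'} q)·A_{(a::l')}F| ≤ ∫ |A_{l'}F − q_a·A_{(a::l')}F| +
∫ |F − (∏_{l'} q)·A_{l'}F|` (sets = `toFinset`; `q_a` blind to the coordinates of `l'`, the tail `l'`
autoregressive). [ours] -/
theorem integral_abs_sub_arHybrid_cons {q : ι → (ι → X) → ℝ} (hqm : ∀ a, Measurable (q a))
    (hq0 : ∀ a ω, 0 ≤ q a ω) {Cq : ℝ} (hqb : ∀ a ω, q a ω ≤ Cq) (hCq : 0 ≤ Cq)
    (hq1 : ∀ a ω, ∫ v, q a (update ω a v) ∂μ = 1) (a : ι) (l' : List ι)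
    (hpw : (a :: l').Pairwise (fun a b => ∀ ω v, q a (update ω b v) = q a ω))
    {F : (ι → X) → ℝ} (hFm : Measurable F) {CF : ℝ} (hFb : ∀ ω, |F ω| ≤ CF) :
    ∫ ω, |F ω - ((a :: l').map fun b => q b ω).prod * coordAvg μ (a :: l').toFinset F ω|
        ∂Measure.pi (fun _ : ι => μ) ≤
      ∫ ω, |coordAvg μ l'.toFinset F ω - q a ω * coordAvg μ (a :: l').toFinset F ω|
          ∂Measure.pi (fun _ : ι => μ) +
        ∫ ω, |F ω - (l'.map fun b => q b ω).prod * coordAvg μ l'.toFinset F ω|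
          ∂Measure.pi (fun _ : ι => μ) := by
  rw [List.pairwise_cons] at hpw
  obtain ⟨ha, hpw'⟩ := hpw
  obtain ⟨hPm, hP0, hPb⟩ := arProd_props hqm hq0 hqb hCq l'
  have hqabs : ∀ ω, |q a ω| ≤ Cq := fun ω => by rw [abs_of_nonneg (hq0 a ω)]; exact hqb a ω
  have hPabs : ∀ ω, |(l'.map fun b => q b ω).prod| ≤ Cq ^ l'.length := fun ω => by
    rw [abs_of_nonneg (hP0 ω)]; exact hPb ω
  set s' : Finset ι := l'.toFinset with hs'
  have hS : (a :: l').toFinset = insert a s' := List.toFinset_cons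
  rw [hS]
  set N' := coordAvg μ s' F with hN'
  set M := coordAvg μ (insert a s') F with hM
  have hN'm : Measurable N' := measurable_coordAvg μ s' hFm
  have hMm : Measurable M := measurable_coordAvg μ (insert a s') hFm
  have hN'b : ∀ ω, |N' ω| ≤ CF := abs_coordAvg_le_of_abs_le μ s' hFm hFb
  have hMb : ∀ ω, |M ω| ≤ CF := abs_coordAvg_le_of_abs_le μ (insert a s') hFm hFb
  -- the middle term's integrand `Ψ = |N' − q_a M|` is blind to the coordinates of `l'`
  set Ψ : (ι → X) → ℝ := fun ω => |N' ω - q a ω * M ω| with hΨ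
  have hΨm : Measurable Ψ := (hN'm.sub ((hqm a).mul hMm)).abs
  have hΨb : ∀ ω, |Ψ ω| ≤ CF + Cq * CF := fun ω => by
    rw [hΨ, abs_abs]
    calc |N' ω - q a ω * M ω| ≤ |N' ω| + |q a ω * M ω| := abs_sub _ _
      _ ≤ CF + Cq * CF := by
          rw [abs_mul]
          exact add_le_add (hN'b ω) (mul_le_mul (hqabs ω) (hMb ω) (abs_nonneg _)
            ((abs_nonneg _).trans (hqabs ω)))
  have hΨl : ∀ b ∈ l', ∀ ω v, Ψ (update ω b v) = Ψ ω := by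
    intro b hb ω v
    have hbs : b ∈ s' := by rw [hs']; exact List.mem_toFinset.2 hb
    have e1 : N' (update ω b v) = N' ω := by
      rw [hN', ← Finset.insert_eq_of_mem hbs]; exact coordAvg_insert_update μ _ b F ω v
    have e2 : M (update ω b v) = M ω := by
      rw [hM, ← Finset.insert_eq_of_mem (Finset.mem_insert_of_mem hbs)]
      exact coordAvg_insert_update μ _ b F ω v
    simp only [hΨ, e1, e2, ha b hb ω v]
  -- pointwise: `F − (q_a Π') M = (F − Π' N') + Π' (N' − q_a M)`
  have hpt : ∀ ω, |F ω - (q a ω * (l'.map fun b => q b ω).prod) * M ω| ≤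
      |F ω - (l'.map fun b => q b ω).prod * N' ω| + Ψ ω * (l'.map fun b => q b ω).prod := by
    intro ω
    have e : F ω - (q a ω * (l'.map fun b => q b ω).prod) * M ω =
        (F ω - (l'.map fun b => q b ω).prod * N' ω) +
          (l'.map fun b => q b ω).prod * (N' ω - q a ω * M ω) := by ring
    rw [e]
    calc |(F ω - (l'.map fun b => q b ω).prod * N' ω) +
          (l'.map fun b => q b ω).prod * (N' ω - q a ω * M ω)|
        ≤ |F ω - (l'.map fun b => q b ω).prod * N' ω| +
          |(l'.map fun b => q b ω).prod * (N' ω - q a ω * M ω)| := abs_add_le _ _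
      _ = |F ω - (l'.map fun b => q b ω).prod * N' ω| + Ψ ω * (l'.map fun b => q b ω).prod := by
          rw [abs_mul, abs_of_nonneg (hP0 ω)]
          simp only [hΨ]
          ring
  -- integrate
  have hI1 : Integrable (fun ω => |F ω - (l'.map fun b => q b ω).prod * N' ω|)
      (Measure.pi fun _ : ι => μ) :=
    integrable_pi_of_abs_le μ (hFm.sub (hPm.mul hN'm)).abs (C := CF + Cq ^ l'.length * CF) (fun ω => by
      rw [abs_abs]
      calc |F ω - (l'.map fun b => q b ω).prod * N' ω| ≤ |F ω| + |(l'.map fun b => q b ω).prod * N' ω| :=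
            abs_sub _ _
        _ ≤ CF + Cq ^ l'.length * CF := by
            rw [abs_mul]
            exact add_le_add (hFb ω) (mul_le_mul (hPabs ω) (hN'b ω) (abs_nonneg _)
              ((abs_nonneg _).trans (hPabs ω))))
  have hI2 : Integrable (fun ω => Ψ ω * (l'.map fun b => q b ω).prod) (Measure.pi fun _ : ι => μ) :=
    integrable_pi_of_abs_le μ (hΨm.mul hPm) (C := (CF + Cq * CF) * Cq ^ l'.length) (fun ω => by
      rw [abs_mul]
      exact mul_le_mul (hΨb ω) (hPabs ω) (abs_nonneg _) ((abs_nonneg _).trans (hΨb ω)))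
  have hI0 : Integrable (fun ω => |F ω - (q a ω * (l'.map fun b => q b ω).prod) * M ω|)
      (Measure.pi fun _ : ι => μ) :=
    integrable_pi_of_abs_le μ (hFm.sub (((hqm a).mul hPm).mul hMm)).abs
      (C := CF + Cq * Cq ^ l'.length * CF) (fun ω => by
      rw [abs_abs]
      calc |F ω - (q a ω * (l'.map fun b => q b ω).prod) * M ω|
          ≤ |F ω| + |(q a ω * (l'.map fun b => q b ω).prod) * M ω| := abs_sub _ _
        _ ≤ CF + Cq * Cq ^ l'.length * CF := by
            rw [abs_mul, abs_mul]
            have h1 : |q a ω| * |(l'.map fun b => q b ω).prod| ≤ Cq * Cq ^ l'.length :=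
              mul_le_mul (hqabs ω) (hPabs ω) (abs_nonneg _) hCq
            exact add_le_add (hFb ω) (mul_le_mul h1 (hMb ω) (abs_nonneg _)
              ((mul_nonneg (abs_nonneg _) (abs_nonneg _)).trans h1)))
  have hmid : ∫ ω, Ψ ω * (l'.map fun b => q b ω).prod ∂Measure.pi (fun _ : ι => μ) =
      ∫ ω, Ψ ω ∂Measure.pi (fun _ : ι => μ) :=
    pi_integral_mul_arTail μ hqm hq0 hqb hq1 l' hpw' hΨm hΨb hΨl
  calc ∫ ω, |F ω - ((a :: l').map fun b => q b ω).prod * M ω| ∂Measure.pi (fun _ : ι => μ)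
      = ∫ ω, |F ω - (q a ω * (l'.map fun b => q b ω).prod) * M ω| ∂Measure.pi (fun _ : ι => μ) := by
        simp only [List.map_cons, List.prod_cons]
    _ ≤ ∫ ω, |F ω - (l'.map fun b => q b ω).prod * N' ω| ∂Measure.pi (fun _ : ι => μ) +
          ∫ ω, Ψ ω * (l'.map fun b => q b ω).prod ∂Measure.pi (fun _ : ι => μ) := by
        rw [← integral_add hI1 hI2]
        exact integral_mono hI0 (hI1.add hI2) hpt
    _ = ∫ ω, Ψ ω ∂Measure.pi (fun _ : ι => μ) +
          ∫ ω, |F ω - (l'.map fun b => q b ω).prod * N' ω| ∂Measure.pi (fun _ : ι => μ) := by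
        rw [hmid, add_comm]

/-- **THE CHAIN**: along an autoregressive block `l = [a₁,…,a_m]` (conditional `q_{a_k}` normalised in
`a_k`, blind to `a_{k+1},…,a_m`), with `s_k = {a_{k+1},…,a_m}`:
`∫ |F − (∏_k q_{a_k})·A_{s_0}F| dπ ≤ Σ_k ∫ |A_{s_k}F − q_{a_k}·A_{s_{k−1}}F| dπ`
(the `k`-th summand pairs `a_k` with the tail `[a_{k+1},…,a_m]`: `l.zip l.tails.tail`). [ours] -/
theorem integral_abs_sub_arHybrid_le_sum {q : ι → (ι → X) → ℝ} (hqm : ∀ a, Measurable (q a))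
    (hq0 : ∀ a ω, 0 ≤ q a ω) {Cq : ℝ} (hqb : ∀ a ω, q a ω ≤ Cq) (hCq : 0 ≤ Cq)
    (hq1 : ∀ a ω, ∫ v, q a (update ω a v) ∂μ = 1)
    {F : (ι → X) → ℝ} (hFm : Measurable F) {CF : ℝ} (hFb : ∀ ω, |F ω| ≤ CF) :
    ∀ (l : List ι), l.Pairwise (fun a b => ∀ ω v, q a (update ω b v) = q a ω) →
      ∫ ω, |F ω - (l.map fun b => q b ω).prod * coordAvg μ l.toFinset F ω| ∂Measure.pi (fun _ : ι => μ) ≤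
        ((l.zip l.tails.tail).map fun c : ι × List ι =>
          ∫ ω, |coordAvg μ c.2.toFinset F ω - q c.1 ω * coordAvg μ (c.1 :: c.2).toFinset F ω|
            ∂Measure.pi (fun _ : ι => μ)).sum := by
  intro l
  induction l with
  | nil =>
    intro _
    simp [coordAvg_empty]
  | cons a l' ih =>
    intro hpw
    have htails : l'.tails = l' :: l'.tails.tail := by cases l' <;> rfl
    have hzip : ((a :: l').zip (a :: l').tails.tail) = (a, l') :: (l'.zip l'.tails.tail) := by
      rw [List.tails_cons, List.tail_cons, htails, List.zip_cons_cons, ← htails]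
    rw [hzip, List.map_cons, List.sum_cons]
    dsimp only
    have hstep := integral_abs_sub_arHybrid_cons μ hqm hq0 hqb hCq hq1 a l' hpw hFm hFb
    have hpw' : l'.Pairwise (fun a b => ∀ ω v, q a (update ω b v) = q a ω) :=
      (List.pairwise_cons.1 hpw).2
    exact hstep.trans (add_le_add le_rfl (ih hpw'))

/-! ## §3 Sufficiency: accurate conditionals give a high acceptance -/

/-- **ACCEPTANCE FLOOR FROM THE SUM OF THE CONDITIONAL ERRORS.**  Target weight `F ≥ 0` (bounded
measurable, `Z = ∫F dπ > 0`), an autoregressive block `l` as in `integral_abs_sub_arHybrid_le_sum`, the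
hybrid proposal `H(ω) = (∏_k q_{a_k}(ω))·A_{s_0}F(ω)/Z` (context exact, block from the model; the full model
when `l` lists every coordinate).  If the error sum `Σ` satisfies `Σ ≤ 2Z` then
`(1 − Σ/(2Z))² ≤ ā = ∫∫ min((F(x)/Z)H(y), (F(y)/Z)H(x)) dπ dπ`. [ours] -/
theorem meanAccept_ge_of_arHybrid {q : ι → (ι → X) → ℝ} (hqm : ∀ a, Measurable (q a))
    (hq0 : ∀ a ω, 0 ≤ q a ω) {Cq : ℝ} (hqb : ∀ a ω, q a ω ≤ Cq) (hCq : 0 ≤ Cq)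
    (hq1 : ∀ a ω, ∫ v, q a (update ω a v) ∂μ = 1)
    {F : (ι → X) → ℝ} (hFm : Measurable F) (hF0 : ∀ ω, 0 ≤ F ω) {CF : ℝ} (hFb : ∀ ω, F ω ≤ CF)
    (hZ : 0 < ∫ ω, F ω ∂Measure.pi (fun _ : ι => μ))
    (l : List ι) (hpw : l.Pairwise (fun a b => ∀ ω v, q a (update ω b v) = q a ω))
    (hsum : ((l.zip l.tails.tail).map fun c : ι × List ι =>
          ∫ ω, |coordAvg μ c.2.toFinset F ω - q c.1 ω * coordAvg μ (c.1 :: c.2).toFinset F ω|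
            ∂Measure.pi (fun _ : ι => μ)).sum ≤ 2 * ∫ ω, F ω ∂Measure.pi (fun _ : ι => μ)) :
    (1 - 1 / (2 * ∫ ω, F ω ∂Measure.pi (fun _ : ι => μ)) *
        ((l.zip l.tails.tail).map fun c : ι × List ι =>
          ∫ ω, |coordAvg μ c.2.toFinset F ω - q c.1 ω * coordAvg μ (c.1 :: c.2).toFinset F ω|
            ∂Measure.pi (fun _ : ι => μ)).sum) ^ 2 ≤
      ∫ x, ∫ y, min
          (F x / (∫ ω, F ω ∂Measure.pi (fun _ : ι => μ)) *
            ((l.map fun b => q b y).prod * coordAvg μ l.toFinset F y /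
              ∫ ω, F ω ∂Measure.pi (fun _ : ι => μ)))
          (F y / (∫ ω, F ω ∂Measure.pi (fun _ : ι => μ)) *
            ((l.map fun b => q b x).prod * coordAvg μ l.toFinset F x /
              ∫ ω, F ω ∂Measure.pi (fun _ : ι => μ)))
          ∂Measure.pi (fun _ : ι => μ) ∂Measure.pi (fun _ : ι => μ) := by
  set Z : ℝ := ∫ ω, F ω ∂Measure.pi (fun _ : ι => μ) with hZdef
  set S : ℝ := ((l.zip l.tails.tail).map fun c : ι × List ι =>
    ∫ ω, |coordAvg μ c.2.toFinset F ω - q c.1 ω * coordAvg μ (c.1 :: c.2).toFinset F ω|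
      ∂Measure.pi (fun _ : ι => μ)).sum with hSdef
  obtain ⟨hPm, hP0, hPb⟩ := arProd_props hqm hq0 hqb hCq l
  have hFabs : ∀ ω, |F ω| ≤ CF := fun ω => by rw [abs_of_nonneg (hF0 ω)]; exact hFb ω
  have hPabs : ∀ ω, |(l.map fun b => q b ω).prod| ≤ Cq ^ l.length := fun ω => by
    rw [abs_of_nonneg (hP0 ω)]; exact hPb ω
  set A := coordAvg μ l.toFinset F with hA
  have hAm : Measurable A := measurable_coordAvg μ l.toFinset hFm
  have hA0 : ∀ ω, 0 ≤ A ω := fun ω => (coordAvg_mem_Icc μ l.toFinset hFm hF0 hFb ω).1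
  have hAb : ∀ ω, |A ω| ≤ CF := abs_coordAvg_le_of_abs_le μ l.toFinset hFm hFabs
  -- target density `p = F/Z`
  have hpm : Measurable fun ω => F ω / Z := hFm.div_const Z
  have hp0 : ∀ ω, 0 ≤ F ω / Z := fun ω => div_nonneg (hF0 ω) hZ.le
  have hpi : Integrable (fun ω => F ω / Z) (Measure.pi fun _ : ι => μ) :=
    integrable_pi_of_abs_le μ hpm (C := CF / Z) (fun ω => by
      rw [abs_of_nonneg (hp0 ω)]; exact div_le_div_of_nonneg_right (hFb ω) hZ.le)
  have hp1 : ∫ ω, F ω / Z ∂Measure.pi (fun _ : ι => μ) = 1 := by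
    rw [integral_div, ← hZdef, div_self hZ.ne']
  -- proposal density `H = Π·A/Z`
  have hHm : Measurable fun ω => (l.map fun b => q b ω).prod * A ω / Z := (hPm.mul hAm).div_const Z
  have hH0 : ∀ ω, 0 ≤ (l.map fun b => q b ω).prod * A ω / Z := fun ω =>
    div_nonneg (mul_nonneg (hP0 ω) (hA0 ω)) hZ.le
  have hPAm : Measurable fun ω => (l.map fun b => q b ω).prod * A ω := hPm.mul hAm
  have hPAb : ∀ ω, |(l.map fun b => q b ω).prod * A ω| ≤ Cq ^ l.length * CF := fun ω => by
    rw [abs_mul]; exact mul_le_mul (hPabs ω) (hAb ω) (abs_nonneg _) ((abs_nonneg _).trans (hPabs ω))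
  have hHi : Integrable (fun ω => (l.map fun b => q b ω).prod * A ω / Z) (Measure.pi fun _ : ι => μ) :=
    (integrable_pi_of_abs_le μ hPAm hPAb).div_const Z
  have hAl : ∀ b ∈ l, ∀ ω v, A (update ω b v) = A ω := by
    intro b hb ω v
    rw [hA, ← Finset.insert_eq_of_mem (List.mem_toFinset.2 hb)]
    exact coordAvg_insert_update μ _ b F ω v
  have hH1 : ∫ ω, (l.map fun b => q b ω).prod * A ω / Z ∂Measure.pi (fun _ : ι => μ) = 1 := by
    rw [integral_div]
    have e : ∫ ω, (l.map fun b => q b ω).prod * A ω ∂Measure.pi (fun _ : ι => μ) = Z := by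
      calc ∫ ω, (l.map fun b => q b ω).prod * A ω ∂Measure.pi (fun _ : ι => μ)
          = ∫ ω, A ω * (l.map fun b => q b ω).prod ∂Measure.pi (fun _ : ι => μ) := by
            simp_rw [mul_comm]
        _ = ∫ ω, A ω ∂Measure.pi (fun _ : ι => μ) :=
            pi_integral_mul_arTail μ hqm hq0 hqb hq1 l hpw hAm hAb hAl
        _ = Z := by rw [hA, pi_integral_coordAvg μ l.toFinset hFm hFabs]
    rw [e, div_self hZ.ne']
  -- the overlap `m = 1 − ½∫|p − H| ≥ 1 − S/(2Z)`
  have hov := integral_min_eq_one_sub_half_integral_abs hpi hHi hp1 hH1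
  have hchain := integral_abs_sub_arHybrid_le_sum μ hqm hq0 hqb hCq hq1 hFm hFabs l hpw
  have hL1 : ∫ ω, |F ω / Z - (l.map fun b => q b ω).prod * A ω / Z| ∂Measure.pi (fun _ : ι => μ) =
      Z⁻¹ * ∫ ω, |F ω - (l.map fun b => q b ω).prod * A ω| ∂Measure.pi (fun _ : ι => μ) := by
    rw [← integral_const_mul]
    refine integral_congr_ae (ae_of_all _ fun ω => ?_)
    show |F ω / Z - (l.map fun b => q b ω).prod * A ω / Z| = Z⁻¹ * |F ω - (l.map fun b => q b ω).prod * A ω|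
    rw [← sub_div, abs_div, abs_of_pos hZ, div_eq_inv_mul]
  have hm_ge : 1 - 1 / (2 * Z) * S ≤
      ∫ ω, min (F ω / Z) ((l.map fun b => q b ω).prod * A ω / Z) ∂Measure.pi (fun _ : ι => μ) := by
    rw [hov, hL1]
    have h1 : Z⁻¹ * ∫ ω, |F ω - (l.map fun b => q b ω).prod * A ω| ∂Measure.pi (fun _ : ι => μ) ≤
        Z⁻¹ * S := mul_le_mul_of_nonneg_left hchain (inv_nonneg.2 hZ.le)
    have e : 1 / (2 * Z) * S = (1 / 2) * (Z⁻¹ * S) := by ring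
    rw [e]
    linarith
  have hm0 : 0 ≤ 1 - 1 / (2 * Z) * S := by
    have e : 1 / (2 * Z) * S = S / (2 * Z) := by ring
    rw [e, sub_nonneg, div_le_one (by positivity)]
    linarith
  -- `m² ≤ ā` (tree)
  have hsq := overlap_sq_le_meanAccept (μ := Measure.pi fun _ : ι => μ) hp0 hpm hpi hH0 hHm hHi hH1
  calc (1 - 1 / (2 * Z) * S) ^ 2
      ≤ (∫ ω, min (F ω / Z) ((l.map fun b => q b ω).prod * A ω / Z) ∂Measure.pi (fun _ : ι => μ)) ^ 2 :=
        pow_le_pow_left₀ hm0 hm_ge 2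
    _ ≤ _ := hsq

end Summit.Ventures.LatticeQCDFlow.Theory2.Autoregressive

end
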